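/-
Origin: expansion seat `planner-pub-hodgecm-mc-axioms-1-g14-0`, handover #W6 2026-08-20T15:53:55Z md5 23c94786b90f (PKG b12835fb4f62 → 23c94786b90f; 415 l.; MECHANICAL (iib-R) rewrite v3.1 of the PKG file as it stands (24 token edits; rules R1x1+RX[h₂']x23)) (`HOME/mc/pub-hodgecm-mc-axioms-1-g14/revendor/kit-r55/stage55/HodgeCM/Model/ArchKTypeOfSlotRec.lean`, md5 23c94786b90f, 415 lines);
landed by the gen-22 packager (p-g22) in gate run 55 REPLACES the earlier landed copy of `HodgeCM/Model/ArchKTypeOfSlotRec.lean` (seat copy carried the packager Origin header of an earlier run (stripped)).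
-/
/-
Copyright (c) 2026. Released under Apache 2.0 license as described in the file LICENSE.
Cell pub-hodgecm, MODEL layer (construction prover mc-carch-1, gen 2), BINDER-OWNERS rows 12/14/15: the literal-slot term of #CA13 at
binder-2's vacuum exponent tuple OF RECORD (`HypCensus/PlaceExponents.placeVacExponents`), so that the junction (K) is DISCHARGED and the
scalar identity (χ) is a statement about a NAMED tuple.
-/
import Summits.HodgeConjecture.HodgeCM.Model.ArchKTypeOfSlot
import Summits.HodgeConjecture.HodgeCM.Model.HypCensus.PlaceExponents

/-!
# The slot term at the exponent of record: `lineVacExponentsZero/One`, `archKTypeOfSlotZeroRec/OneRec`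

For E's lines k = 0, 1 in the literal slot `(Unit, Empty)` (#CA13): the four sign facts bundled (`lineSign_zero/one`, binder-2's `hsign`
shape), **`lineVacExponents… eR eS := placeVacExponents … (blockPosEquiv V) (blockNegEquiv V) eR eS (lineSign_…) (slot datum)`** — binder-2's
ONE choice of record at the pin `(frameD V, lineVec d_k)`, `v₁`, with BOTH its inputs discharged here — its pinned difference `e_P − e_Q = 1`,
(K) `cmBlockRepAt_κ_tensorPi_lineVacExponents…` (binder-2 `cmBlockRepAt_κ_tensorPi_placeVacExponents`), and the terms
**`archKTypeOfSlotZeroRec/OneRec`** = #CA13's `archKTypeOfSlotZero/One` at `(ev, hK) := (lineVacExponents…, …)` with rows 14/15 for them and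
the `k`-dispatch `archKTypeOfSlotRec k hk`.
Remaining inputs of row 12 in the C lane after this file: `hlevel` (L3) · `arch₀` ((E1), rfl at theta-3's datum) · `harch` (c5) · `hfin` (D-2) ·
`hsec` (route (a) of (TWIST-2); holds as typed in the branch `(mk ι₁).embedding = ι₁`) · **`hχ_k : c_k(u) · det A(u)^{e_P} · d(u)^{e_Q} = d̄(u)`
at `e := lineVacExponents_k`** · positivity data `eR_k eS_k`.
Nothing is cited and nothing is minted; 0 records, 0 `def … : Prop`.
-/

set_option autoImplicit false

noncomputable section

open Filter Topology Complex
open NumberField NumberField.InfinitePlace NumberField.mixedEmbedding IsDedekindDomain MeasureTheory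
open scoped Matrix TensorProduct Classical SchwartzMap
open MulAction
open Literature.Geometry.ComplexHyperbolic.BallModel (U21 x₀ stabilizerEquivK21)
open Literature.NumberTheory.Automorphic.U21 (K21 matA sclD pPlus pPlus_apply)
open Literature.AlgebraicGeometry.HodgeTheory
open Literature.AlgebraicGeometry.ShimuraVarieties Literature.AlgebraicGeometry.ShimuraVarieties.BallForms
open Literature.NumberTheory.Automorphic Literature.NumberTheory.Weil1964
open Literature.RepresentationTheory.HeisenbergGroup (polar Heisenberg symplecticGroup ofSymplectic)
open Literature.RepresentationTheory.KonnoKonno2007 Literature.RepresentationTheory.KonnoKonno2007.RealDualPair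
open Literature.NumberTheory.GelbartRogawski1991 Literature.NumberTheory.GelbartRogawski1991.UnitaryDualPair
open Literature.Analysis.SegalBargmann Literature.Analysis.Distribution
open Literature.NumberTheory.Automorphic.PicardCM
open HodgeCM.Adelic HodgeCM.PerL34 HodgeCM.Model.HypCensus HodgeCM.Model.SupplyInstance HodgeCM.Model.ArchSideTerm

namespace HodgeCM.Model

section Record

variable (hHD : exists_isReal_hodgeModel) (hI : hodgePQ_independent_of_hodgeModel)
  (h₁ : BallQuotientUniformised)  (h₃ : CMAbelianVarietyRealised)

variable {L : CMField} {ι₁ : L →+* ℂ} (V : HermSpace3 L ι₁) (c : SeesawCtx L)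
  (hGR : (cmSplittingDatum (L : Type) finProdFinEquiv (frameD V) (frameD_real V) (frameD_ne V) (dW c.D) (dW_real c.D)
    (dW_ne c.D)).CompatibleSplitting)
  (hGR₀ : (cmSplittingDatum (L : Type) (e₁) (frameD V) (frameD_real V) (frameD_ne V) (lineVec (L : Type) (dW c.D 0))
    (fun _ => dW_real c.D 0) (fun _ => dW_ne c.D 0)).CompatibleSplitting)
  (hGR₁ : (cmSplittingDatum (L : Type) (e₁) (frameD V) (frameD_real V) (frameD_ne V) (lineVec (L : Type) (dW c.D 1))
    (fun _ => dW_real c.D 1) (fun _ => dW_ne c.D 1)).CompatibleSplitting)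
  (hGR₂ : (cmSplittingDatum (L : Type) (e₁) (frameD V) (frameD_real V) (frameD_ne V) (lineVec (L : Type) (dW' c.D 0))
    (fun _ => dW'_real c.D 0) (fun _ => dW'_ne c.D 0)).CompatibleSplitting)
  (hGR₃ : (cmSplittingDatum (L : Type) (e₁) (frameD V) (frameD_real V) (frameD_ne V) (lineVec (L : Type) (dW' c.D 1))
    (fun _ => dW'_real c.D 1) (fun _ => dW'_ne c.D 1)).CompatibleSplitting)
  (η : CMAdelic (L : Type) (frameD V) × CMAdelic (L : Type) (dW c.D) →* ℂˣ)
  (hη : ∀ γU ∈ CMRat (L : Type) (frameD V), ∀ γ ∈ CMRat (L : Type) (dW c.D), η (γU, γ) = 1)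
  (hηc : Continuous fun p => ((η p : ℂˣ) : ℂ))
  (h₁W : (∀ j, 0 < (ι₁ (dW c.D j)).re) ∨ ∀ j, (ι₁ (dW c.D j)).re < 0)
  (A : ∀ k : Fin 4, ArchLineInput V (lineRepD V c.D hGR hGR₀ hGR₁ hGR₂ hGR₃ η k))
  (hV : IsAnisotropic L V.Hm) (N : ℕ) (Γ₀ : Level V)
  (hlevel : ∀ δ ∈ levelImage hHD hI h₁ h₃ Γ₀ hV, ∃ x : (V.latticeModel printFact_unitaryCompact_holds).G,
    x ∈ (satLevelRegimeOf V hV Γ₀.K : Subgroup (V.latticeModel printFact_unitaryCompact_holds).G) ∧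
      (archSideOf V c hGR hGR₀ hGR₁ hGR₂ hGR₃ η hη hηc h₁W A).ιinf δ * x ∈ (V.latticeModel printFact_unitaryCompact_holds).Γ)
  (Φ₂ : SchwartzMap ((Fin 3 × {v : {v : InfinitePlace ↥(maximalRealSubfield L) // v.IsReal} // v ≠ cmPlace (L : Type) ι₁}) → ℝ) ℂ)


/-! ### line 0 at the exponent of record -/

section ZeroRec

include h₁W in
/-- the four sign facts of line 0 at the pin, bundled as binder-2's `hsign`. -/
theorem lineSign_zero :
    (∃ i₀ : Fin 3, (∀ i, i ≠ i₀ → 0 < (ι₁ (frameD V i)).re) ∨ ∀ i, i ≠ i₀ → (ι₁ (frameD V i)).re < 0) ∧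
    ((∀ j, 0 < (ι₁ (lineVec (L : Type) (dW c.D 0) j)).re) ∨ ∀ j, (ι₁ (lineVec (L : Type) (dW c.D 0) j)).re < 0) ∧
    (∀ τ : (L : Type) →+* ℂ, InfinitePlace.mk τ ≠ InfinitePlace.mk ι₁ →
      (∀ i, 0 < (τ (frameD V i)).re) ∨ ∀ i, (τ (frameD V i)).re < 0) ∧
    (∀ τ : (L : Type) →+* ℂ, InfinitePlace.mk τ ≠ InfinitePlace.mk ι₁ →
      (∃ j₀ : Fin 1, ∀ j, j ≠ j₀ → 0 < (τ (lineVec (L : Type) (dW c.D 0) j)).re) ∨ ∀ j, (τ (lineVec (L : Type) (dW c.D 0) j)).re < 0) :=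
  ⟨frameD_sign_ι₁' V, line_hs₁W h₁W 0, frameD_sign_of_ne V, fun τ hτ => line_hsW (dW c.D 0) τ hτ⟩

variable
  (eR : PosIdx (cmXW (L : Type) (frameD V) (lineVec (L : Type) (dW c.D 0)) (fun _ => dW_real c.D 0) ι₁ (cmPlace (L : Type) ι₁)) ≃ Unit)
  (eS : NegIdx (cmXW (L : Type) (frameD V) (lineVec (L : Type) (dW c.D 0)) (fun _ => dW_real c.D 0) ι₁ (cmPlace (L : Type) ι₁)) ≃ Empty)

/-- **THE VACUUM EXPONENT TUPLE OF RECORD of line 0 at `v₁`** in the literal slot: binder-2's `placeVacExponents` at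
`(eP, eQ, eR, eS) = (blockPosEquiv V, blockNegEquiv V, eR, eS)`, its `hsign`/`hslot` inputs DISCHARGED (`lineSign_zero`, theta-1's slot datum). -/
def lineVacExponentsZero : VacExponents :=
  placeVacExponents (L : Type) e₁ (frameD V) (frameD_real V) (frameD_ne V) (lineVec (L : Type) (dW c.D 0)) (fun _ => dW_real c.D 0)
    (fun _ => dW_ne c.D 0) hGR₀ ι₁ (cmPlace (L : Type) ι₁) (blockPosEquiv V) (blockNegEquiv V) eR eS (lineSign_zero V c h₁W)
    (exists_isArchWeilDatum_lineSlot (R := Unit) (S := Empty))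

/-- its `V`-side difference is `1` (`|Unit| − |Empty|`): `e_P − e_Q = 1`. -/
theorem lineVacExponentsZero_eP_sub_eQ :
    (lineVacExponentsZero V c hGR₀ h₁W eR eS).eP - (lineVacExponentsZero V c hGR₀ h₁W eR eS).eQ = 1 := by
  have h := placeVacExponents_eP_sub_eQ (L : Type) e₁ (frameD V) (frameD_real V) (frameD_ne V)
    (lineVec (L : Type) (dW c.D 0)) (fun _ => dW_real c.D 0) (fun _ => dW_ne c.D 0) hGR₀ ι₁ (cmPlace (L : Type) ι₁) (blockPosEquiv V)
    (blockNegEquiv V) eR eS (lineSign_zero V c h₁W) (exists_isArchWeilDatum_lineSlot (R := Unit) (S := Empty)) (0 : Fin 2) ()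
  simpa [lineVacExponentsZero] using h

/-- (K) for line 0 at the tuple of record (binder-2 `cmBlockRepAt_κ_tensorPi_placeVacExponents`). -/
theorem cmBlockRepAt_κ_tensorPi_lineVacExponentsZero (kk : DPK (Fin 2) Unit Unit Empty)
    (Φ : SchwartzMap (DPIdx (Fin 2) Unit Unit Empty → ℝ) ℂ)
    (Φ₂' : SchwartzMap ((Fin 3 × {v : {v : InfinitePlace ↥(maximalRealSubfield L) // v.IsReal} // v ≠ cmPlace (L : Type) ι₁}) → ℝ) ℂ) :
    cmBlockRepAt (L : Type) e₁ (frameD V) (frameD_real V) (frameD_ne V) (lineVec (L : Type) (dW c.D 0)) (fun _ => dW_real c.D 0)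
        (fun _ => dW_ne c.D 0) hGR₀ ι₁ (cmPlace (L : Type) ι₁) (blockPosEquiv V) (blockNegEquiv V) eR eS
        (cmBlockSectionAt (L : Type) (frameD V) (frameD_real V) (frameD_ne V) (lineVec (L : Type) (dW c.D 0)) (fun _ => dW_real c.D 0)
          (fun _ => dW_ne c.D 0) ι₁ (cmPlace (L : Type) ι₁) (blockPosEquiv V) (blockNegEquiv V) eR eS (κ _ _ _ _ kk)) (tensorPi Φ Φ₂') =
      tensorPi (κOp _ _ (lineVacExponentsZero V c hGR₀ h₁W eR eS) kk Φ) Φ₂' :=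
  cmBlockRepAt_κ_tensorPi_placeVacExponents (L : Type) e₁ (frameD V) (frameD_real V) (frameD_ne V)
    (lineVec (L : Type) (dW c.D 0)) (fun _ => dW_real c.D 0) (fun _ => dW_ne c.D 0) hGR₀ ι₁ (cmPlace (L : Type) ι₁) (blockPosEquiv V)
    (blockNegEquiv V) eR eS (lineSign_zero V c h₁W) (exists_isArchWeilDatum_lineSlot (R := Unit) (S := Empty)) kk Φ Φ₂'

variable
  (ℓ₀ : Module.Dual ℂ (Fin 2 → ℂ))
  (arch₀ : blockFamilyOfAt (L : Type) e₁ (frameD V) (frameD_real V) (frameD_ne V) (lineVec (L : Type) (dW c.D 0))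
      (fun _ => dW_real c.D 0) (fun _ => dW_ne c.D 0) ι₁ (blockPosEquiv V) (blockNegEquiv V) eR eS (degOnePDual Empty) Φ₂ ℓ₀ =
    (A 0).Φinf)
  (harch : ∀ a : UnitaryGroup.arch (↥(maximalRealSubfield L)) L (IsCMField.complexConj L) 3 V.Hm,
    UnitaryGroup.archAt (↥(maximalRealSubfield L)) L (IsCMField.complexConj L) 3 V.Hm (UnitaryGroup.cmPlace (L : Type) ι₁)
        (NumberField.complexConj_smul_infinitePlace (L : Type) _) (IsCMField.complexConj_ne_one (L : Type)) a = 1 →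
    ∀ ℓ, ((archSideOf V c hGR hGR₀ hGR₁ hGR₂ hGR₃ η hη hηc h₁W A).P 0).ω
        (HodgeCM.Adelic.regimeEquiv L V.Hm hV
          (UnitaryGroup.archToAdelic (↥(maximalRealSubfield L)) L (IsCMField.complexConj L) 3 V.Hm a), 1)
        (testFun (↥(maximalRealSubfield L)) (Fin 3)
          (blockFamilyOfAt (L : Type) e₁ (frameD V) (frameD_real V) (frameD_ne V) (lineVec (L : Type) (dW c.D 0))
            (fun _ => dW_real c.D 0) (fun _ => dW_ne c.D 0) ι₁ (blockPosEquiv V) (blockNegEquiv V) eR eS (degOnePDual Empty) Φ₂ ℓ)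
          (A 0).x₀ N) =
      testFun (↥(maximalRealSubfield L)) (Fin 3)
        (blockFamilyOfAt (L : Type) e₁ (frameD V) (frameD_real V) (frameD_ne V) (lineVec (L : Type) (dW c.D 0))
          (fun _ => dW_real c.D 0) (fun _ => dW_ne c.D 0) ι₁ (blockPosEquiv V) (blockNegEquiv V) eR eS (degOnePDual Empty) Φ₂ ℓ) (A 0).x₀ N)
  (hfin : ∀ kf : UnitaryGroup.finAdelic (↥(maximalRealSubfield L)) L (IsCMField.complexConj L) 3 V.Hm, kf ∈ Γ₀.K →
    ∀ Φinf : 𝓢((Fin 3 → mixedSpace (↥(maximalRealSubfield L))), ℂ),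
      ((archSideOf V c hGR hGR₀ hGR₁ hGR₂ hGR₃ η hη hηc h₁W A).P 0).ω
          (HodgeCM.Adelic.regimeEquiv L V.Hm hV
            (UnitaryGroup.finAdelicToAdelic (↥(maximalRealSubfield L)) L (IsCMField.complexConj L) 3 V.Hm kf), 1)
          (testFun (↥(maximalRealSubfield L)) (Fin 3) Φinf (A 0).x₀ N) =
        testFun (↥(maximalRealSubfield L)) (Fin 3) Φinf (A 0).x₀ N)
  (hsec : ∀ u : stabilizer U21 x₀,
    cmBlockSectionAt (L : Type) (frameD V) (frameD_real V) (frameD_ne V) (lineVec (L : Type) (dW c.D 0)) (fun _ => dW_real c.D 0)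
        (fun _ => dW_ne c.D 0) ι₁ (cmPlace (L : Type) ι₁) (blockPosEquiv V) (blockNegEquiv V) eR eS (u21FrameEquiv (u : U21), 1) =
      (archSectionFrameOf V u, 1))
  (hχ : ∀ u : stabilizer U21 x₀,
    ((lineScalar_zero V c.D hGR hGR₀ hGR₁ (eta₀ V c.D η) (u : U21) : ℂˣ) : ℂ) *
        ((matA (stabilizerEquivK21.symm u)).det ^ (lineVacExponentsZero V c hGR₀ h₁W eR eS).eP *
          sclD (stabilizerEquivK21.symm u) ^ (lineVacExponentsZero V c hGR₀ h₁W eR eS).eQ) =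
      star (sclD (stabilizerEquivK21.symm u)))


/-- **ROW 12 FOR LINE 0 IN THE LITERAL SLOT AT THE EXPONENT OF RECORD** — (K) discharged; inputs {`hlevel`, `arch₀`, `harch`, `hfin`,
`hsec`, `hχ`} + the positivity data `eR eS`. -/
def archKTypeOfSlotZeroRec :
    ArchKTypeData (thetaSpaceInputIn hHD hI h₁ h₃ (archSideOf V c hGR hGR₀ hGR₁ hGR₂ hGR₃ η hη hηc h₁W A) hV) 0 N :=
  archKTypeOfSlotZero hHD hI h₁ h₃ V c hGR hGR₀ hGR₁ hGR₂ hGR₃ η hη hηc h₁W A hV N Γ₀ hlevel Φ₂ eR eS ℓ₀ arch₀ harch hfin hsec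
    (fun kk Φ => cmBlockRepAt_κ_tensorPi_lineVacExponentsZero V c hGR₀ h₁W eR eS kk Φ Φ₂) hχ

/-- row 14 for it (no further hypothesis). -/
theorem isWeaklyPDiff_archKTypeOfSlotZeroRec :
    (archKTypeOfSlotZeroRec hHD hI h₁ h₃ V c hGR hGR₀ hGR₁ hGR₂ hGR₃ η hη hηc h₁W A hV N Γ₀ hlevel Φ₂ eR eS ℓ₀ arch₀ harch hfin hsec hχ).IsWeaklyPDiff BallForms.expP :=
  isWeaklyPDiff_archKTypeOfSlotZero hHD hI h₁ h₃ V c hGR hGR₀ hGR₁ hGR₂ hGR₃ η hη hηc h₁W A hV N Γ₀ hlevel Φ₂ eR eS ℓ₀ arch₀ harch hfin hsec _ hχ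

/-- row 15 for it along `twistU21 ∘ expP` (no further hypothesis). -/
theorem isPMinusKilledAlong_archKTypeOfSlotZeroRec_twist (p : Fin 2) :
    (archKTypeOfSlotZeroRec hHD hI h₁ h₃ V c hGR hGR₀ hGR₁ hGR₂ hGR₃ η hη hηc h₁W A hV N Γ₀ hlevel Φ₂ eR eS ℓ₀ arch₀ harch hfin hsec hχ).IsPMinusKilledAlong (fun b => twistU21 L ι₁ (BallForms.expP b))
      (-Complex.I • (Pi.single p 1 : Fin 2 → ℂ)) :=
  isPMinusKilledAlong_archKTypeOfSlotZero_twist hHD hI h₁ h₃ V c hGR hGR₀ hGR₁ hGR₂ hGR₃ η hη hηc h₁W A hV N Γ₀ hlevel Φ₂ eR eS ℓ₀ arch₀ harch hfin hsec _ hχ p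


/-- **row 15 ALONG `expP` ITSELF in the branch `(mk ι₁).embedding = ι₁`** (there `twistU21 = id`; the other branch is the (TWIST-2) item). -/
theorem isPMinusKilledAlong_archKTypeOfSlotZeroRec_of_embedding_eq (h : (InfinitePlace.mk ι₁).embedding = ι₁) (p : Fin 2) :
    (archKTypeOfSlotZeroRec hHD hI h₁ h₃ V c hGR hGR₀ hGR₁ hGR₂ hGR₃ η hη hηc h₁W A hV N Γ₀ hlevel Φ₂ eR eS ℓ₀ arch₀ harch hfin hsec hχ).IsPMinusKilledAlong BallForms.expP
      (-Complex.I • (Pi.single p 1 : Fin 2 → ℂ)) := by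
  have e : (fun b => twistU21 L ι₁ (BallForms.expP b)) = BallForms.expP := funext fun b => twistU21_eq_self_of_embedding_eq h _
  rw [← e]
  exact isPMinusKilledAlong_archKTypeOfSlotZeroRec_twist hHD hI h₁ h₃ V c hGR hGR₀ hGR₁ hGR₂ hGR₃ η hη hηc h₁W A hV N Γ₀ hlevel Φ₂ eR eS ℓ₀ arch₀ harch hfin hsec hχ p

end ZeroRec

/-! ### line 1 at the exponent of record -/

section OneRec

include h₁W in
/-- the four sign facts of line 1 at the pin, bundled as binder-2's `hsign`. -/
theorem lineSign_one :
    (∃ i₀ : Fin 3, (∀ i, i ≠ i₀ → 0 < (ι₁ (frameD V i)).re) ∨ ∀ i, i ≠ i₀ → (ι₁ (frameD V i)).re < 0) ∧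
    ((∀ j, 0 < (ι₁ (lineVec (L : Type) (dW c.D 1) j)).re) ∨ ∀ j, (ι₁ (lineVec (L : Type) (dW c.D 1) j)).re < 0) ∧
    (∀ τ : (L : Type) →+* ℂ, InfinitePlace.mk τ ≠ InfinitePlace.mk ι₁ →
      (∀ i, 0 < (τ (frameD V i)).re) ∨ ∀ i, (τ (frameD V i)).re < 0) ∧
    (∀ τ : (L : Type) →+* ℂ, InfinitePlace.mk τ ≠ InfinitePlace.mk ι₁ →
      (∃ j₀ : Fin 1, ∀ j, j ≠ j₀ → 0 < (τ (lineVec (L : Type) (dW c.D 1) j)).re) ∨ ∀ j, (τ (lineVec (L : Type) (dW c.D 1) j)).re < 0) :=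
  ⟨frameD_sign_ι₁' V, line_hs₁W h₁W 1, frameD_sign_of_ne V, fun τ hτ => line_hsW (dW c.D 1) τ hτ⟩

variable
  (eR : PosIdx (cmXW (L : Type) (frameD V) (lineVec (L : Type) (dW c.D 1)) (fun _ => dW_real c.D 1) ι₁ (cmPlace (L : Type) ι₁)) ≃ Unit)
  (eS : NegIdx (cmXW (L : Type) (frameD V) (lineVec (L : Type) (dW c.D 1)) (fun _ => dW_real c.D 1) ι₁ (cmPlace (L : Type) ι₁)) ≃ Empty)

/-- **THE VACUUM EXPONENT TUPLE OF RECORD of line 1 at `v₁`** in the literal slot: binder-2's `placeVacExponents` at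
`(eP, eQ, eR, eS) = (blockPosEquiv V, blockNegEquiv V, eR, eS)`, its `hsign`/`hslot` inputs DISCHARGED (`lineSign_one`, theta-1's slot datum). -/
def lineVacExponentsOne : VacExponents :=
  placeVacExponents (L : Type) e₁ (frameD V) (frameD_real V) (frameD_ne V) (lineVec (L : Type) (dW c.D 1)) (fun _ => dW_real c.D 1)
    (fun _ => dW_ne c.D 1) hGR₁ ι₁ (cmPlace (L : Type) ι₁) (blockPosEquiv V) (blockNegEquiv V) eR eS (lineSign_one V c h₁W)
    (exists_isArchWeilDatum_lineSlot (R := Unit) (S := Empty))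

/-- its `V`-side difference is `1` (`|Unit| − |Empty|`): `e_P − e_Q = 1`. -/
theorem lineVacExponentsOne_eP_sub_eQ :
    (lineVacExponentsOne V c hGR₁ h₁W eR eS).eP - (lineVacExponentsOne V c hGR₁ h₁W eR eS).eQ = 1 := by
  have h := placeVacExponents_eP_sub_eQ (L : Type) e₁ (frameD V) (frameD_real V) (frameD_ne V)
    (lineVec (L : Type) (dW c.D 1)) (fun _ => dW_real c.D 1) (fun _ => dW_ne c.D 1) hGR₁ ι₁ (cmPlace (L : Type) ι₁) (blockPosEquiv V)
    (blockNegEquiv V) eR eS (lineSign_one V c h₁W) (exists_isArchWeilDatum_lineSlot (R := Unit) (S := Empty)) (0 : Fin 2) ()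
  simpa [lineVacExponentsOne] using h

/-- (K) for line 1 at the tuple of record (binder-2 `cmBlockRepAt_κ_tensorPi_placeVacExponents`). -/
theorem cmBlockRepAt_κ_tensorPi_lineVacExponentsOne (kk : DPK (Fin 2) Unit Unit Empty)
    (Φ : SchwartzMap (DPIdx (Fin 2) Unit Unit Empty → ℝ) ℂ)
    (Φ₂' : SchwartzMap ((Fin 3 × {v : {v : InfinitePlace ↥(maximalRealSubfield L) // v.IsReal} // v ≠ cmPlace (L : Type) ι₁}) → ℝ) ℂ) :
    cmBlockRepAt (L : Type) e₁ (frameD V) (frameD_real V) (frameD_ne V) (lineVec (L : Type) (dW c.D 1)) (fun _ => dW_real c.D 1)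
        (fun _ => dW_ne c.D 1) hGR₁ ι₁ (cmPlace (L : Type) ι₁) (blockPosEquiv V) (blockNegEquiv V) eR eS
        (cmBlockSectionAt (L : Type) (frameD V) (frameD_real V) (frameD_ne V) (lineVec (L : Type) (dW c.D 1)) (fun _ => dW_real c.D 1)
          (fun _ => dW_ne c.D 1) ι₁ (cmPlace (L : Type) ι₁) (blockPosEquiv V) (blockNegEquiv V) eR eS (κ _ _ _ _ kk)) (tensorPi Φ Φ₂') =
      tensorPi (κOp _ _ (lineVacExponentsOne V c hGR₁ h₁W eR eS) kk Φ) Φ₂' :=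
  cmBlockRepAt_κ_tensorPi_placeVacExponents (L : Type) e₁ (frameD V) (frameD_real V) (frameD_ne V)
    (lineVec (L : Type) (dW c.D 1)) (fun _ => dW_real c.D 1) (fun _ => dW_ne c.D 1) hGR₁ ι₁ (cmPlace (L : Type) ι₁) (blockPosEquiv V)
    (blockNegEquiv V) eR eS (lineSign_one V c h₁W) (exists_isArchWeilDatum_lineSlot (R := Unit) (S := Empty)) kk Φ Φ₂'

variable
  (ℓ₀ : Module.Dual ℂ (Fin 2 → ℂ))
  (arch₀ : blockFamilyOfAt (L : Type) e₁ (frameD V) (frameD_real V) (frameD_ne V) (lineVec (L : Type) (dW c.D 1))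
      (fun _ => dW_real c.D 1) (fun _ => dW_ne c.D 1) ι₁ (blockPosEquiv V) (blockNegEquiv V) eR eS (degOnePDual Empty) Φ₂ ℓ₀ =
    (A 1).Φinf)
  (harch : ∀ a : UnitaryGroup.arch (↥(maximalRealSubfield L)) L (IsCMField.complexConj L) 3 V.Hm,
    UnitaryGroup.archAt (↥(maximalRealSubfield L)) L (IsCMField.complexConj L) 3 V.Hm (UnitaryGroup.cmPlace (L : Type) ι₁)
        (NumberField.complexConj_smul_infinitePlace (L : Type) _) (IsCMField.complexConj_ne_one (L : Type)) a = 1 →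
    ∀ ℓ, ((archSideOf V c hGR hGR₀ hGR₁ hGR₂ hGR₃ η hη hηc h₁W A).P 1).ω
        (HodgeCM.Adelic.regimeEquiv L V.Hm hV
          (UnitaryGroup.archToAdelic (↥(maximalRealSubfield L)) L (IsCMField.complexConj L) 3 V.Hm a), 1)
        (testFun (↥(maximalRealSubfield L)) (Fin 3)
          (blockFamilyOfAt (L : Type) e₁ (frameD V) (frameD_real V) (frameD_ne V) (lineVec (L : Type) (dW c.D 1))
            (fun _ => dW_real c.D 1) (fun _ => dW_ne c.D 1) ι₁ (blockPosEquiv V) (blockNegEquiv V) eR eS (degOnePDual Empty) Φ₂ ℓ)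
          (A 1).x₀ N) =
      testFun (↥(maximalRealSubfield L)) (Fin 3)
        (blockFamilyOfAt (L : Type) e₁ (frameD V) (frameD_real V) (frameD_ne V) (lineVec (L : Type) (dW c.D 1))
          (fun _ => dW_real c.D 1) (fun _ => dW_ne c.D 1) ι₁ (blockPosEquiv V) (blockNegEquiv V) eR eS (degOnePDual Empty) Φ₂ ℓ) (A 1).x₀ N)
  (hfin : ∀ kf : UnitaryGroup.finAdelic (↥(maximalRealSubfield L)) L (IsCMField.complexConj L) 3 V.Hm, kf ∈ Γ₀.K →
    ∀ Φinf : 𝓢((Fin 3 → mixedSpace (↥(maximalRealSubfield L))), ℂ),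
      ((archSideOf V c hGR hGR₀ hGR₁ hGR₂ hGR₃ η hη hηc h₁W A).P 1).ω
          (HodgeCM.Adelic.regimeEquiv L V.Hm hV
            (UnitaryGroup.finAdelicToAdelic (↥(maximalRealSubfield L)) L (IsCMField.complexConj L) 3 V.Hm kf), 1)
          (testFun (↥(maximalRealSubfield L)) (Fin 3) Φinf (A 1).x₀ N) =
        testFun (↥(maximalRealSubfield L)) (Fin 3) Φinf (A 1).x₀ N)
  (hsec : ∀ u : stabilizer U21 x₀,
    cmBlockSectionAt (L : Type) (frameD V) (frameD_real V) (frameD_ne V) (lineVec (L : Type) (dW c.D 1)) (fun _ => dW_real c.D 1)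
        (fun _ => dW_ne c.D 1) ι₁ (cmPlace (L : Type) ι₁) (blockPosEquiv V) (blockNegEquiv V) eR eS (u21FrameEquiv (u : U21), 1) =
      (archSectionFrameOf V u, 1))
  (hχ : ∀ u : stabilizer U21 x₀,
    ((lineScalar_one V c.D hGR hGR₀ hGR₁ (eta₁ V c.D η) (u : U21) : ℂˣ) : ℂ) *
        ((matA (stabilizerEquivK21.symm u)).det ^ (lineVacExponentsOne V c hGR₁ h₁W eR eS).eP *
          sclD (stabilizerEquivK21.symm u) ^ (lineVacExponentsOne V c hGR₁ h₁W eR eS).eQ) =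
      star (sclD (stabilizerEquivK21.symm u)))


/-- **ROW 12 FOR LINE 1 IN THE LITERAL SLOT AT THE EXPONENT OF RECORD** — (K) discharged; inputs {`hlevel`, `arch₀`, `harch`, `hfin`,
`hsec`, `hχ`} + the positivity data `eR eS`. -/
def archKTypeOfSlotOneRec :
    ArchKTypeData (thetaSpaceInputIn hHD hI h₁ h₃ (archSideOf V c hGR hGR₀ hGR₁ hGR₂ hGR₃ η hη hηc h₁W A) hV) 1 N :=
  archKTypeOfSlotOne hHD hI h₁ h₃ V c hGR hGR₀ hGR₁ hGR₂ hGR₃ η hη hηc h₁W A hV N Γ₀ hlevel Φ₂ eR eS ℓ₀ arch₀ harch hfin hsec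
    (fun kk Φ => cmBlockRepAt_κ_tensorPi_lineVacExponentsOne V c hGR₁ h₁W eR eS kk Φ Φ₂) hχ

/-- row 14 for it (no further hypothesis). -/
theorem isWeaklyPDiff_archKTypeOfSlotOneRec :
    (archKTypeOfSlotOneRec hHD hI h₁ h₃ V c hGR hGR₀ hGR₁ hGR₂ hGR₃ η hη hηc h₁W A hV N Γ₀ hlevel Φ₂ eR eS ℓ₀ arch₀ harch hfin hsec hχ).IsWeaklyPDiff BallForms.expP :=
  isWeaklyPDiff_archKTypeOfSlotOne hHD hI h₁ h₃ V c hGR hGR₀ hGR₁ hGR₂ hGR₃ η hη hηc h₁W A hV N Γ₀ hlevel Φ₂ eR eS ℓ₀ arch₀ harch hfin hsec _ hχ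

/-- row 15 for it along `twistU21 ∘ expP` (no further hypothesis). -/
theorem isPMinusKilledAlong_archKTypeOfSlotOneRec_twist (p : Fin 2) :
    (archKTypeOfSlotOneRec hHD hI h₁ h₃ V c hGR hGR₀ hGR₁ hGR₂ hGR₃ η hη hηc h₁W A hV N Γ₀ hlevel Φ₂ eR eS ℓ₀ arch₀ harch hfin hsec hχ).IsPMinusKilledAlong (fun b => twistU21 L ι₁ (BallForms.expP b))
      (-Complex.I • (Pi.single p 1 : Fin 2 → ℂ)) :=
  isPMinusKilledAlong_archKTypeOfSlotOne_twist hHD hI h₁ h₃ V c hGR hGR₀ hGR₁ hGR₂ hGR₃ η hη hηc h₁W A hV N Γ₀ hlevel Φ₂ eR eS ℓ₀ arch₀ harch hfin hsec _ hχ p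


/-- **row 15 ALONG `expP` ITSELF in the branch `(mk ι₁).embedding = ι₁`** (there `twistU21 = id`; the other branch is the (TWIST-2) item). -/
theorem isPMinusKilledAlong_archKTypeOfSlotOneRec_of_embedding_eq (h : (InfinitePlace.mk ι₁).embedding = ι₁) (p : Fin 2) :
    (archKTypeOfSlotOneRec hHD hI h₁ h₃ V c hGR hGR₀ hGR₁ hGR₂ hGR₃ η hη hηc h₁W A hV N Γ₀ hlevel Φ₂ eR eS ℓ₀ arch₀ harch hfin hsec hχ).IsPMinusKilledAlong BallForms.expP
      (-Complex.I • (Pi.single p 1 : Fin 2 → ℂ)) := by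
  have e : (fun b => twistU21 L ι₁ (BallForms.expP b)) = BallForms.expP := funext fun b => twistU21_eq_self_of_embedding_eq h _
  rw [← e]
  exact isPMinusKilledAlong_archKTypeOfSlotOneRec_twist hHD hI h₁ h₃ V c hGR hGR₀ hGR₁ hGR₂ hGR₃ η hη hηc h₁W A hV N Γ₀ hlevel Φ₂ eR eS ℓ₀ arch₀ harch hfin hsec hχ p

end OneRec

/-! ### E's binder shape at the exponent of record: the `k`-dispatch -/

section DispatchRec

variable
  (eR₀' : PosIdx (cmXW (L : Type) (frameD V) (lineVec (L : Type) (dW c.D 0)) (fun _ => dW_real c.D 0) ι₁ (cmPlace (L : Type) ι₁)) ≃ Unit)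
  (eS₀' : NegIdx (cmXW (L : Type) (frameD V) (lineVec (L : Type) (dW c.D 0)) (fun _ => dW_real c.D 0) ι₁ (cmPlace (L : Type) ι₁)) ≃ Empty)

variable
  (ℓ₀₀' : Module.Dual ℂ (Fin 2 → ℂ))
  (arch₀₀' : blockFamilyOfAt (L : Type) e₁ (frameD V) (frameD_real V) (frameD_ne V) (lineVec (L : Type) (dW c.D 0))
      (fun _ => dW_real c.D 0) (fun _ => dW_ne c.D 0) ι₁ (blockPosEquiv V) (blockNegEquiv V) eR₀' eS₀' (degOnePDual Empty) Φ₂ ℓ₀₀' =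
    (A 0).Φinf)
  (harch₀' : ∀ a : UnitaryGroup.arch (↥(maximalRealSubfield L)) L (IsCMField.complexConj L) 3 V.Hm,
    UnitaryGroup.archAt (↥(maximalRealSubfield L)) L (IsCMField.complexConj L) 3 V.Hm (UnitaryGroup.cmPlace (L : Type) ι₁)
        (NumberField.complexConj_smul_infinitePlace (L : Type) _) (IsCMField.complexConj_ne_one (L : Type)) a = 1 →
    ∀ ℓ, ((archSideOf V c hGR hGR₀ hGR₁ hGR₂ hGR₃ η hη hηc h₁W A).P 0).ω
        (HodgeCM.Adelic.regimeEquiv L V.Hm hV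
          (UnitaryGroup.archToAdelic (↥(maximalRealSubfield L)) L (IsCMField.complexConj L) 3 V.Hm a), 1)
        (testFun (↥(maximalRealSubfield L)) (Fin 3)
          (blockFamilyOfAt (L : Type) e₁ (frameD V) (frameD_real V) (frameD_ne V) (lineVec (L : Type) (dW c.D 0))
            (fun _ => dW_real c.D 0) (fun _ => dW_ne c.D 0) ι₁ (blockPosEquiv V) (blockNegEquiv V) eR₀' eS₀' (degOnePDual Empty) Φ₂ ℓ)
          (A 0).x₀ N) =
      testFun (↥(maximalRealSubfield L)) (Fin 3)
        (blockFamilyOfAt (L : Type) e₁ (frameD V) (frameD_real V) (frameD_ne V) (lineVec (L : Type) (dW c.D 0))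
          (fun _ => dW_real c.D 0) (fun _ => dW_ne c.D 0) ι₁ (blockPosEquiv V) (blockNegEquiv V) eR₀' eS₀' (degOnePDual Empty) Φ₂ ℓ) (A 0).x₀ N)
  (hfin₀' : ∀ kf : UnitaryGroup.finAdelic (↥(maximalRealSubfield L)) L (IsCMField.complexConj L) 3 V.Hm, kf ∈ Γ₀.K →
    ∀ Φinf : 𝓢((Fin 3 → mixedSpace (↥(maximalRealSubfield L))), ℂ),
      ((archSideOf V c hGR hGR₀ hGR₁ hGR₂ hGR₃ η hη hηc h₁W A).P 0).ω
          (HodgeCM.Adelic.regimeEquiv L V.Hm hV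
            (UnitaryGroup.finAdelicToAdelic (↥(maximalRealSubfield L)) L (IsCMField.complexConj L) 3 V.Hm kf), 1)
          (testFun (↥(maximalRealSubfield L)) (Fin 3) Φinf (A 0).x₀ N) =
        testFun (↥(maximalRealSubfield L)) (Fin 3) Φinf (A 0).x₀ N)
  (hsec₀' : ∀ u : stabilizer U21 x₀,
    cmBlockSectionAt (L : Type) (frameD V) (frameD_real V) (frameD_ne V) (lineVec (L : Type) (dW c.D 0)) (fun _ => dW_real c.D 0)
        (fun _ => dW_ne c.D 0) ι₁ (cmPlace (L : Type) ι₁) (blockPosEquiv V) (blockNegEquiv V) eR₀' eS₀' (u21FrameEquiv (u : U21), 1) =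
      (archSectionFrameOf V u, 1))
  (hχ₀' : ∀ u : stabilizer U21 x₀,
    ((lineScalar_zero V c.D hGR hGR₀ hGR₁ (eta₀ V c.D η) (u : U21) : ℂˣ) : ℂ) *
        ((matA (stabilizerEquivK21.symm u)).det ^ (lineVacExponentsZero V c hGR₀ h₁W eR₀' eS₀').eP *
          sclD (stabilizerEquivK21.symm u) ^ (lineVacExponentsZero V c hGR₀ h₁W eR₀' eS₀').eQ) =
      star (sclD (stabilizerEquivK21.symm u)))


variable
  (eR₁' : PosIdx (cmXW (L : Type) (frameD V) (lineVec (L : Type) (dW c.D 1)) (fun _ => dW_real c.D 1) ι₁ (cmPlace (L : Type) ι₁)) ≃ Unit)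
  (eS₁' : NegIdx (cmXW (L : Type) (frameD V) (lineVec (L : Type) (dW c.D 1)) (fun _ => dW_real c.D 1) ι₁ (cmPlace (L : Type) ι₁)) ≃ Empty)

variable
  (ℓ₀₁' : Module.Dual ℂ (Fin 2 → ℂ))
  (arch₀₁' : blockFamilyOfAt (L : Type) e₁ (frameD V) (frameD_real V) (frameD_ne V) (lineVec (L : Type) (dW c.D 1))
      (fun _ => dW_real c.D 1) (fun _ => dW_ne c.D 1) ι₁ (blockPosEquiv V) (blockNegEquiv V) eR₁' eS₁' (degOnePDual Empty) Φ₂ ℓ₀₁' =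
    (A 1).Φinf)
  (harch₁' : ∀ a : UnitaryGroup.arch (↥(maximalRealSubfield L)) L (IsCMField.complexConj L) 3 V.Hm,
    UnitaryGroup.archAt (↥(maximalRealSubfield L)) L (IsCMField.complexConj L) 3 V.Hm (UnitaryGroup.cmPlace (L : Type) ι₁)
        (NumberField.complexConj_smul_infinitePlace (L : Type) _) (IsCMField.complexConj_ne_one (L : Type)) a = 1 →
    ∀ ℓ, ((archSideOf V c hGR hGR₀ hGR₁ hGR₂ hGR₃ η hη hηc h₁W A).P 1).ω
        (HodgeCM.Adelic.regimeEquiv L V.Hm hV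
          (UnitaryGroup.archToAdelic (↥(maximalRealSubfield L)) L (IsCMField.complexConj L) 3 V.Hm a), 1)
        (testFun (↥(maximalRealSubfield L)) (Fin 3)
          (blockFamilyOfAt (L : Type) e₁ (frameD V) (frameD_real V) (frameD_ne V) (lineVec (L : Type) (dW c.D 1))
            (fun _ => dW_real c.D 1) (fun _ => dW_ne c.D 1) ι₁ (blockPosEquiv V) (blockNegEquiv V) eR₁' eS₁' (degOnePDual Empty) Φ₂ ℓ)
          (A 1).x₀ N) =
      testFun (↥(maximalRealSubfield L)) (Fin 3)
        (blockFamilyOfAt (L : Type) e₁ (frameD V) (frameD_real V) (frameD_ne V) (lineVec (L : Type) (dW c.D 1))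
          (fun _ => dW_real c.D 1) (fun _ => dW_ne c.D 1) ι₁ (blockPosEquiv V) (blockNegEquiv V) eR₁' eS₁' (degOnePDual Empty) Φ₂ ℓ) (A 1).x₀ N)
  (hfin₁' : ∀ kf : UnitaryGroup.finAdelic (↥(maximalRealSubfield L)) L (IsCMField.complexConj L) 3 V.Hm, kf ∈ Γ₀.K →
    ∀ Φinf : 𝓢((Fin 3 → mixedSpace (↥(maximalRealSubfield L))), ℂ),
      ((archSideOf V c hGR hGR₀ hGR₁ hGR₂ hGR₃ η hη hηc h₁W A).P 1).ω
          (HodgeCM.Adelic.regimeEquiv L V.Hm hV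
            (UnitaryGroup.finAdelicToAdelic (↥(maximalRealSubfield L)) L (IsCMField.complexConj L) 3 V.Hm kf), 1)
          (testFun (↥(maximalRealSubfield L)) (Fin 3) Φinf (A 1).x₀ N) =
        testFun (↥(maximalRealSubfield L)) (Fin 3) Φinf (A 1).x₀ N)
  (hsec₁' : ∀ u : stabilizer U21 x₀,
    cmBlockSectionAt (L : Type) (frameD V) (frameD_real V) (frameD_ne V) (lineVec (L : Type) (dW c.D 1)) (fun _ => dW_real c.D 1)
        (fun _ => dW_ne c.D 1) ι₁ (cmPlace (L : Type) ι₁) (blockPosEquiv V) (blockNegEquiv V) eR₁' eS₁' (u21FrameEquiv (u : U21), 1) =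
      (archSectionFrameOf V u, 1))
  (hχ₁' : ∀ u : stabilizer U21 x₀,
    ((lineScalar_one V c.D hGR hGR₀ hGR₁ (eta₁ V c.D η) (u : U21) : ℂˣ) : ℂ) *
        ((matA (stabilizerEquivK21.symm u)).det ^ (lineVacExponentsOne V c hGR₁ h₁W eR₁' eS₁').eP *
          sclD (stabilizerEquivK21.symm u) ^ (lineVacExponentsOne V c hGR₁ h₁W eR₁' eS₁').eQ) =
      star (sclD (stabilizerEquivK21.symm u)))




-- port_pkg: scope closed for this part
end DispatchRec
end Record
end HodgeCM.Model
end
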